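import Mathlib
import Summits.ResolutionOfSingularities.ResolutionOfSingularities.Theorems.HomologicalConductorPersistenceBranchedCoverDescent
import HarnessLib

/-!
# K-SD0 `StrictDrop` (stmt-ResolutionOfSingularities-16485) / rung S-2 `PersistenceSurface` (stmt-…-19970) — the cA-ARENA,
# UPPER HALF and ENABLING FORMULA:
# `ca(S[u,v]/(v² − u² + h)) = ρ⁻¹(ca(S/(h)))` along `ρ : u, v ↦ 0` (two branched-cover descents)

Route `ResolutionOfSingularities/HomologicalConductor`, chain W4.4b (cell `res-hironaka`).  `[OURS · L1 w44b · res-L1-w44b-stub-2 gen 4]`; NOT a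
statement of the manuscript under review (Hironaka 2017), no statement of that manuscript is used; AI-written, weaker than expert review.
(The former crux `Persistence` stmt-…-16484 is closed — refuted, p546734; this file serves the chain's StrictDrop / PersistenceSurface programme.)

THE ARENA in `(u, v)`-coordinates.  For a noetherian ring `S` (the centre's ambient ring, e.g. `k[z₁,…,z_r]`) and `h ∈ S⁰` put
`g := u² − h = X² + C(−h) ∈ S[u]`, `f₁ := −g`, and `T := S[u][v]/(v² + f₁) = S[u,v]/(v² − u² + h) = AdjoinRoot (X² + C f₁)`.
With `x := u + v`, `y := u − v` one has `xy = u² − v² = h`: when `2 ∈ Sˣ`, `T ≅ S[x,y]/(xy − h)` is the cA-arena `T_h` of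
`…PersistenceArenaGeneral` (p544909) over the centre `C_h = S/(h)`.  The natural surjection `ρ : T ↠ S/(h)` (`u, v ↦ 0`) factors as
`T —π₁→ S[u]/(f₁) ≅ AdjoinRoot g —π₂→ S/(−h) ≅ S/(h)`, two branched double covers, so `…PersistenceBranchedCoverDescent` (p547208/p547845) applies twice:

* **`map_cohomologyAnnihilatorOfDegree_le`** (UPPER HALF, every noetherian `S`, every `h ∈ S⁰`, no characteristic hypothesis):
  `(caⁿ⁺³(T)).map ρ ≤ caⁿ⁺¹(S/(h))` for ANY ring map `ρ` with `ρ(v) = ρ(u) = 0`, `ρ(s) = s̄` — i.e. `ca(T_h) ⊆ (x, y) + ca(C_h)·T_h`;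
* **`cohomologyAnnihilator_eq_comap`** (BOTH HALVES): `ca(T) = ρ⁻¹(ca(S/(h)))` when `2 ∈ Sˣ` and `S[u]`, `S[u][v]` have finite global
  dimension (`caᵈ⁺²(S[u]) = ⊤`, `caᵈ⁺³(S[u][v]) = ⊤`);
* **`cohomologyAnnihilator_eq_comap_mvPolynomial`**: the case `S = k[z₁,…,z_m]`, `char k ≠ 2`, `h ≠ 0`, hypotheses discharged by Hilbert's
  syzygy theorem: **`ca(k[z,u,v]/(v² − u² + h)) = ρ⁻¹(ca(k[z]/(h)))`** — the ENABLING FORMULA `ca(T_h) = (x,y) + ι(ca(C_h))·T_h` of the chain's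
  Persistence/StrictDrop programme (plan-1 K-v13 (c), CRUX-PLAN-SD-v0 (O3)), in every dimension, for every hypersurface centre, fact-free.

References (mechanism only): Ö. Esentepe, J. Algebra 541 (2020) Thm 5.4 [`Esentepe2020`]; H. Knörrer, Invent. Math. 88 (1987).
-/

noncomputable section

-- single-problem summit: the doubled namespace component `ResolutionOfSingularities` is forced
set_option linter.dupNamespace false

namespace Summit.ResolutionOfSingularities.ResolutionOfSingularities.Theorems.HomologicalConductor.ArenaDescent

open Polynomial Literature.RingTheory.CohomologyAnnihilator
open Summit.ResolutionOfSingularities.ResolutionOfSingularities.Theorems.HomologicalConductor.BranchedCoverDescent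
open scoped nonZeroDivisors

universe u

variable {S : Type u} [CommRing S]

/-! ## §1 Non-zero-divisors and the four maps of the factorisation of `ρ` -/

/-- `a ∈ S⁰ → −a ∈ S⁰`. [folklore] -/
theorem neg_mem_nonZeroDivisors {a : S} (ha : a ∈ S⁰) : -a ∈ S⁰ := by
  rw [mem_nonZeroDivisors_iff_right] at ha ⊢
  intro x hx
  rw [mul_neg, neg_eq_zero] at hx
  exact ha x hx

/-- `f₁ = −(u² − h) ∈ S[u]⁰` (`u² − h` is monic). [folklore] -/
theorem f₁_mem_nonZeroDivisors (h : S) : (-(X ^ 2 + C (-h)) : S[X]) ∈ (S[X])⁰ :=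
  neg_mem_nonZeroDivisors (monic_gen (-h) le_rfl).mem_nonZeroDivisors


/-- The kernel condition for `π₁ : T = S[u][v]/(v² + f₁) → S[u]/(f₁)`, `v ↦ 0`. [folklore] -/
theorem eval₂_gen_eq_zero {R : Type u} [CommRing R] (f : R) :
    eval₂ (Ideal.Quotient.mk (Ideal.span {f})) (0 : R ⧸ Ideal.span {f}) (X ^ 2 + C f : R[X]) = 0 := by
  rw [eval₂_add, eval₂_X_pow, eval₂_C, zero_pow (by omega), zero_add, Ideal.Quotient.eq_zero_iff_mem]
  exact Ideal.mem_span_singleton_self f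

/-- `(f₁) = (g)` as ideals of `S[u]` (`f₁ = −g`). [folklore] -/
theorem span_f₁_eq (h : S) : Ideal.span {(-(X ^ 2 + C (-h)) : S[X])} = Ideal.span {(X ^ 2 + C (-h) : S[X])} :=
  Ideal.span_singleton_neg _

/-- `AdjoinRoot.mk g` kills `(f₁) = (−g)`. [folklore] -/
theorem mk_eq_zero_of_mem_span_f₁ (h : S) (q : S[X]) (hq : q ∈ Ideal.span {(-(X ^ 2 + C (-h)) : S[X])}) :
    AdjoinRoot.mk (X ^ 2 + C (-h) : S[X]) q = 0 := by
  rw [AdjoinRoot.mk_eq_zero]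
  rw [Ideal.mem_span_singleton] at hq
  exact (neg_dvd.mp hq)

/-- The identification `e₁ : S[u]/(f₁) → AdjoinRoot g` (`f₁ = −g`) induced by `AdjoinRoot.mk g` is bijective. [folklore] -/
theorem bijective_lift_mk (h : S) :
    Function.Bijective (Ideal.Quotient.lift (Ideal.span {(-(X ^ 2 + C (-h)) : S[X])})
      (AdjoinRoot.mk (X ^ 2 + C (-h) : S[X])) (mk_eq_zero_of_mem_span_f₁ h)) := by
  constructor
  · rw [injective_iff_map_eq_zero]
    intro x hx
    obtain ⟨q, rfl⟩ := Ideal.Quotient.mk_surjective x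
    rw [Ideal.Quotient.lift_mk, AdjoinRoot.mk_eq_zero] at hx
    rw [Ideal.Quotient.eq_zero_iff_mem, Ideal.mem_span_singleton]
    exact neg_dvd.mpr hx
  · intro y
    obtain ⟨q, rfl⟩ := AdjoinRoot.mk_surjective y
    exact ⟨Ideal.Quotient.mk _ q, by rw [Ideal.Quotient.lift_mk]⟩

/-! ## §2 UPPER HALF: `(caⁿ⁺³(T)).map ρ ≤ caⁿ⁺¹(S/(h))` -/

/-- A ring map `ρ : T = S[u][v]/(v² + f₁) → S/(h)` with `ρ(v) = 0`, `ρ(u) = 0`, `ρ(s) = s̄` IS the composite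
`T —π₁→ S[u]/(f₁) —e₁→ AdjoinRoot (u² − h) —π₂→ S/(−h) —e₂→ S/(h)` (uniqueness of maps out of `AdjoinRoot`). [folklore] -/
theorem eq_comp (h : S) (ρ : AdjoinRoot (X ^ 2 + C (-(X ^ 2 + C (-h))) : S[X][X]) →+* S ⧸ Ideal.span {h})
    (hρv : ρ (AdjoinRoot.root _) = 0) (hρu : ρ (AdjoinRoot.of _ X) = 0)
    (hρC : ∀ s : S, ρ (AdjoinRoot.of _ (C s)) = Ideal.Quotient.mk (Ideal.span {h}) s)
    (t : AdjoinRoot (X ^ 2 + C (-(X ^ 2 + C (-h))) : S[X][X])) :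
    ρ t = Ideal.quotEquivOfEq (Ideal.span_singleton_neg h)
      (AdjoinRoot.lift (Ideal.Quotient.mk (Ideal.span {-h})) (0 : S ⧸ Ideal.span {-h}) (eval₂_gen_eq_zero (-h))
        (RingEquiv.ofBijective _ (bijective_lift_mk h)
          (AdjoinRoot.lift (Ideal.Quotient.mk (Ideal.span {(-(X ^ 2 + C (-h)) : S[X])}))
            (0 : S[X] ⧸ Ideal.span {(-(X ^ 2 + C (-h)) : S[X])}) (eval₂_gen_eq_zero _) t))) := by
  set π₁ : AdjoinRoot (X ^ 2 + C (-(X ^ 2 + C (-h))) : S[X][X]) →+* S[X] ⧸ Ideal.span {(-(X ^ 2 + C (-h)) : S[X])} :=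
    AdjoinRoot.lift (Ideal.Quotient.mk _) 0 (eval₂_gen_eq_zero _) with hπ₁
  set e₁ : (S[X] ⧸ Ideal.span {(-(X ^ 2 + C (-h)) : S[X])}) ≃+* AdjoinRoot (X ^ 2 + C (-h) : S[X]) :=
    RingEquiv.ofBijective _ (bijective_lift_mk h) with he₁
  set π₂ : AdjoinRoot (X ^ 2 + C (-h) : S[X]) →+* S ⧸ Ideal.span {-h} :=
    AdjoinRoot.lift (Ideal.Quotient.mk _) 0 (eval₂_gen_eq_zero _) with hπ₂
  set e₂ : (S ⧸ Ideal.span {-h}) ≃+* S ⧸ Ideal.span {h} := Ideal.quotEquivOfEq (Ideal.span_singleton_neg h) with he₂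
  -- values of the composite on generators
  have k₁ : ∀ q : S[X], e₁ (π₁ (AdjoinRoot.of _ q)) = AdjoinRoot.mk (X ^ 2 + C (-h) : S[X]) q := fun q => by
    rw [hπ₁, AdjoinRoot.lift_of, he₁, RingEquiv.ofBijective_apply, Ideal.Quotient.lift_mk]
  have k₂ : ∀ s : S, e₂ (π₂ (AdjoinRoot.of _ s)) = Ideal.Quotient.mk (Ideal.span {h}) s := fun s => by
    rw [hπ₂, AdjoinRoot.lift_of, he₂, Ideal.quotEquivOfEq_mk]
  have hC : ρ.comp (AdjoinRoot.of _) = (e₂.toRingHom.comp (π₂.comp (e₁.toRingHom.comp π₁))).comp (AdjoinRoot.of _) := by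
    refine Polynomial.ringHom_ext (fun s => ?_) ?_
    · rw [RingHom.comp_apply, hρC, RingHom.comp_apply, RingHom.comp_apply, RingHom.comp_apply, RingHom.comp_apply,
        RingEquiv.toRingHom_eq_coe, RingEquiv.toRingHom_eq_coe, RingHom.coe_coe, RingHom.coe_coe, k₁, AdjoinRoot.mk_C, k₂]
    · rw [RingHom.comp_apply, hρu, RingHom.comp_apply, RingHom.comp_apply, RingHom.comp_apply, RingHom.comp_apply,
        RingEquiv.toRingHom_eq_coe, RingEquiv.toRingHom_eq_coe, RingHom.coe_coe, RingHom.coe_coe, k₁, AdjoinRoot.mk_X,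
        hπ₂, AdjoinRoot.lift_root, map_zero]
  obtain ⟨p, rfl⟩ := AdjoinRoot.mk_surjective t
  have hp : AdjoinRoot.mk (X ^ 2 + C (-(X ^ 2 + C (-h))) : S[X][X]) p = p.eval₂ (AdjoinRoot.of _) (AdjoinRoot.root _) := by
    rw [← AdjoinRoot.aeval_eq, Polynomial.aeval_def, AdjoinRoot.algebraMap_eq]
  have hv : (e₂.toRingHom.comp (π₂.comp (e₁.toRingHom.comp π₁))) (AdjoinRoot.root (X ^ 2 + C (-(X ^ 2 + C (-h))) : S[X][X])) = 0 := by
    rw [RingHom.comp_apply, RingHom.comp_apply, RingHom.comp_apply, hπ₁, AdjoinRoot.lift_root, map_zero, map_zero, map_zero]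
  have hE : e₂ (π₂ (e₁ (π₁ (AdjoinRoot.mk _ p)))) = (e₂.toRingHom.comp (π₂.comp (e₁.toRingHom.comp π₁))) (AdjoinRoot.mk _ p) := by
    rw [RingHom.comp_apply, RingHom.comp_apply, RingHom.comp_apply, RingEquiv.toRingHom_eq_coe, RingEquiv.toRingHom_eq_coe,
      RingHom.coe_coe, RingHom.coe_coe]
  rw [hE, hp, Polynomial.hom_eval₂, Polynomial.hom_eval₂, hC, hρv, hv]

/-- **cA-ARENA, UPPER HALF** for the composite `e₂ ∘ π₂ ∘ e₁ ∘ π₁ : T → S/(h)` (every noetherian `S`, every `h ∈ S⁰`):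
two applications of `BranchedCoverDescent.map_cohomologyAnnihilatorOfDegree_le_quotient`. [OURS · L1 w44b] -/
theorem comp_apply_mem_cohomologyAnnihilatorOfDegree [IsNoetherianRing S] [Nontrivial S] (h : S) (hh : h ∈ S⁰) {n : ℕ}
    {c : AdjoinRoot (X ^ 2 + C (-(X ^ 2 + C (-h))) : S[X][X])}
    (hc : c ∈ cohomologyAnnihilatorOfDegree (AdjoinRoot (X ^ 2 + C (-(X ^ 2 + C (-h))) : S[X][X])) (n + 3)) :
    Ideal.quotEquivOfEq (Ideal.span_singleton_neg h)
      (AdjoinRoot.lift (Ideal.Quotient.mk (Ideal.span {-h})) (0 : S ⧸ Ideal.span {-h}) (eval₂_gen_eq_zero (-h))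
        (RingEquiv.ofBijective _ (bijective_lift_mk h)
          (AdjoinRoot.lift (Ideal.Quotient.mk (Ideal.span {(-(X ^ 2 + C (-h)) : S[X])}))
            (0 : S[X] ⧸ Ideal.span {(-(X ^ 2 + C (-h)) : S[X])}) (eval₂_gen_eq_zero _) c))) ∈
      cohomologyAnnihilatorOfDegree (S ⧸ Ideal.span {h}) (n + 1) := by
  have D1 := map_cohomologyAnnihilatorOfDegree_le_quotient (S := S[X]) (-(X ^ 2 + C (-h)) : S[X])
    (f₁_mem_nonZeroDivisors h) le_rfl (n + 1)
  have D2 := map_cohomologyAnnihilatorOfDegree_le_quotient (S := S) (-h) (neg_mem_nonZeroDivisors hh) le_rfl n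
  rw [Ideal.map_le_iff_le_comap] at D1 D2
  have h1 := D1 hc
  rw [Ideal.mem_comap] at h1
  have h2 := ringEquiv_apply_mem_cohomologyAnnihilatorOfDegree (RingEquiv.ofBijective _ (bijective_lift_mk h)) h1
  have h3 := D2 h2
  rw [Ideal.mem_comap] at h3
  exact ringEquiv_apply_mem_cohomologyAnnihilatorOfDegree (Ideal.quotEquivOfEq (Ideal.span_singleton_neg h)) h3

/-- **cA-ARENA, UPPER HALF** (every noetherian `S`, every `h ∈ S⁰`, no characteristic hypothesis): for
`T = S[u][v]/(v² − u² + h) = AdjoinRoot (X² + C f₁)`, `f₁ = −(u² − h)`, and ANY ring map `ρ : T → S/(h)` with `ρ(v) = 0`,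
`ρ(u) = 0`, `ρ(s) = s̄`: `(caⁿ⁺³(T)).map ρ ≤ caⁿ⁺¹(S/(h))` — i.e. `ca(T_h) ⊆ (x, y) + ca(C_h)·T_h` for the arena
`T_h = S[x,y]/(xy − h)` (`x = u + v`, `y = u − v`). [OURS · L1 w44b] -/
theorem map_cohomologyAnnihilatorOfDegree_le [IsNoetherianRing S] [Nontrivial S] (h : S) (hh : h ∈ S⁰) (n : ℕ)
    (ρ : AdjoinRoot (X ^ 2 + C (-(X ^ 2 + C (-h))) : S[X][X]) →+* S ⧸ Ideal.span {h})
    (hρv : ρ (AdjoinRoot.root _) = 0) (hρu : ρ (AdjoinRoot.of _ X) = 0)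
    (hρC : ∀ s : S, ρ (AdjoinRoot.of _ (C s)) = Ideal.Quotient.mk (Ideal.span {h}) s) :
    (cohomologyAnnihilatorOfDegree (AdjoinRoot (X ^ 2 + C (-(X ^ 2 + C (-h))) : S[X][X])) (n + 3)).map ρ ≤
      cohomologyAnnihilatorOfDegree (S ⧸ Ideal.span {h}) (n + 1) := by
  rw [Ideal.map_le_iff_le_comap]
  intro c hc
  rw [Ideal.mem_comap, eq_comp h ρ hρv hρu hρC c]
  exact comp_apply_mem_cohomologyAnnihilatorOfDegree h hh hc

/-- `ca`-form of the upper half: `(ca(T)).map ρ ≤ ca(S/(h))`. [OURS · L1 w44b] -/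
theorem map_cohomologyAnnihilator_le [IsNoetherianRing S] [Nontrivial S] (h : S) (hh : h ∈ S⁰)
    (ρ : AdjoinRoot (X ^ 2 + C (-(X ^ 2 + C (-h))) : S[X][X]) →+* S ⧸ Ideal.span {h})
    (hρv : ρ (AdjoinRoot.root _) = 0) (hρu : ρ (AdjoinRoot.of _ X) = 0)
    (hρC : ∀ s : S, ρ (AdjoinRoot.of _ (C s)) = Ideal.Quotient.mk (Ideal.span {h}) s) :
    (cohomologyAnnihilator (AdjoinRoot (X ^ 2 + C (-(X ^ 2 + C (-h))) : S[X][X]))).map ρ ≤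
      cohomologyAnnihilator (S ⧸ Ideal.span {h}) := by
  rw [Ideal.map_le_iff_le_comap]
  intro c hc
  obtain ⟨n, hn⟩ := mem_cohomologyAnnihilator_iff.mp hc
  have hc' := cohomologyAnnihilatorOfDegree_mono (show n ≤ n + 3 by omega) hn
  exact cohomologyAnnihilatorOfDegree_le (n + 1) ((Ideal.map_le_iff_le_comap.mp (map_cohomologyAnnihilatorOfDegree_le h hh n ρ hρv hρu hρC)) hc')

/-! ## §3 BOTH HALVES: `ca(T) = ρ⁻¹(ca(S/(h)))` when `2 ∈ Sˣ` and `S[u]`, `S[u][v]` have finite global dimension -/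

/-- `ca` across a ring isomorphism, membership form: `x ∈ ca(R) ↔ e x ∈ ca(R')`. [folklore] -/
theorem mem_cohomologyAnnihilator_iff_of_ringEquiv {R R' : Type u} [CommRing R] [CommRing R'] (e : R ≃+* R') (x : R) :
    x ∈ cohomologyAnnihilator R ↔ e x ∈ cohomologyAnnihilator R' := by
  constructor
  · intro hx
    obtain ⟨n, hn⟩ := mem_cohomologyAnnihilator_iff.mp hx
    exact cohomologyAnnihilatorOfDegree_le n (ringEquiv_apply_mem_cohomologyAnnihilatorOfDegree e hn)
  · intro hx
    obtain ⟨n, hn⟩ := mem_cohomologyAnnihilator_iff.mp hx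
    have h' := ringEquiv_apply_mem_cohomologyAnnihilatorOfDegree e.symm hn
    rw [e.symm_apply_apply] at h'
    exact cohomologyAnnihilatorOfDegree_le n h'

/-- `2 ∈ Sˣ ⇒ 2 ∈ S[u]ˣ`. [folklore] -/
theorem isUnit_two_polynomial (h2 : IsUnit (2 : S)) : IsUnit (2 : S[X]) := by
  have h' := h2.map (Polynomial.C : S →+* S[X])
  rwa [map_ofNat] at h'

/-- **cA-ARENA, BOTH HALVES: `ca(S[u][v]/(v² − u² + h)) = ρ⁻¹(ca(S/(h)))`** for `h ∈ S⁰`, `2 ∈ Sˣ`, and `S[u]`, `S[u][v]` of finite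
global dimension in the sense `caᵈ⁺²(S[u]) = ⊤`, `caᵈ⁺³(S[u][v]) = ⊤` (`ρ` any ring map with `ρ(v) = ρ(u) = 0`, `ρ(s) = s̄`) — the
ENABLING FORMULA `ca(T_h) = (x, y) + ca(C_h)·T_h` of the arena over the hypersurface centre `C_h = S/(h)`: two applications of
`BranchedCoverDescent.cohomologyAnnihilator_eq_comap` (THEOREM DP both halves, `m = 2`). [OURS · L1 w44b] -/
theorem cohomologyAnnihilator_eq_comap [IsNoetherianRing S] [Nontrivial S] (h : S) (hh : h ∈ S⁰) {d : ℕ}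
    (hSu : cohomologyAnnihilatorOfDegree S[X] (d + 2) = ⊤) (hSuv : cohomologyAnnihilatorOfDegree S[X][X] (d + 3) = ⊤)
    (h2 : IsUnit (2 : S)) (ρ : AdjoinRoot (X ^ 2 + C (-(X ^ 2 + C (-h))) : S[X][X]) →+* S ⧸ Ideal.span {h})
    (hρv : ρ (AdjoinRoot.root _) = 0) (hρu : ρ (AdjoinRoot.of _ X) = 0)
    (hρC : ∀ s : S, ρ (AdjoinRoot.of _ (C s)) = Ideal.Quotient.mk (Ideal.span {h}) s) :
    cohomologyAnnihilator (AdjoinRoot (X ^ 2 + C (-(X ^ 2 + C (-h))) : S[X][X])) =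
      (cohomologyAnnihilator (S ⧸ Ideal.span {h})).comap ρ := by
  have E1 := BranchedCoverDescent.cohomologyAnnihilator_eq_comap (S := S[X]) (-(X ^ 2 + C (-h)) : S[X])
    (f₁_mem_nonZeroDivisors h) (d := d + 1) hSuv (isUnit_two_polynomial h2)
  have E2 := BranchedCoverDescent.cohomologyAnnihilator_eq_comap (S := S) (-h) (neg_mem_nonZeroDivisors hh) (d := d) hSu h2
  ext t
  rw [Ideal.mem_comap, eq_comp h ρ hρv hρu hρC t, E1, Ideal.mem_comap,
    mem_cohomologyAnnihilator_iff_of_ringEquiv (RingEquiv.ofBijective _ (bijective_lift_mk h)), E2, Ideal.mem_comap,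
    mem_cohomologyAnnihilator_iff_of_ringEquiv (Ideal.quotEquivOfEq (Ideal.span_singleton_neg h))]

/-! ## §4 The arena over `k[z₁,…,z_m]` (`char k ≠ 2`): hypotheses discharged by Hilbert's syzygy theorem -/

/-- `2 ∈ k[z]ˣ` when `2 ≠ 0` in the field `k`. [folklore] -/
theorem isUnit_two_mvPolynomial {k : Type u} [Field k] (h2 : (2 : k) ≠ 0) (m : ℕ) : IsUnit (2 : MvPolynomial (Fin m) k) := by
  have h' := (isUnit_iff_ne_zero.mpr h2).map (MvPolynomial.C : k →+* MvPolynomial (Fin m) k)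
  rwa [map_ofNat] at h'

/-- Hilbert's syzygy theorem for `k[z₁,…,z_m][u]`: `caᵐ⁺²(k[z][u]) = ⊤` (transport along `finSuccEquiv`). [folklore] -/
theorem cohomologyAnnihilatorOfDegree_polynomial_mvPolynomial_eq_top (k : Type u) [Field k] (m : ℕ) :
    cohomologyAnnihilatorOfDegree (MvPolynomial (Fin m) k)[X] (m + 2) = ⊤ := by
  have H : cohomologyAnnihilatorOfDegree (MvPolynomial (Fin (m + 1)) k) (m + 2) = ⊤ :=
    cohomologyAnnihilatorOfDegree_mvPolynomial_eq_top k (m + 1)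
  rw [← map_ringEquiv_cohomologyAnnihilatorOfDegree (MvPolynomial.finSuccEquiv k m).toRingEquiv (m + 2), H, Ideal.map_top]

/-- Hilbert's syzygy theorem for `k[z₁,…,z_m][u][v]`: `caᵐ⁺³(k[z][u][v]) = ⊤`. [folklore] -/
theorem cohomologyAnnihilatorOfDegree_polynomial_polynomial_mvPolynomial_eq_top (k : Type u) [Field k] (m : ℕ) :
    cohomologyAnnihilatorOfDegree (MvPolynomial (Fin m) k)[X][X] (m + 3) = ⊤ := by
  have H : cohomologyAnnihilatorOfDegree (MvPolynomial (Fin (m + 2)) k) (m + 3) = ⊤ :=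
    cohomologyAnnihilatorOfDegree_mvPolynomial_eq_top k (m + 2)
  rw [← map_ringEquiv_cohomologyAnnihilatorOfDegree ((MvPolynomial.finSuccEquiv k (m + 1)).toRingEquiv.trans
    (Polynomial.mapEquiv (MvPolynomial.finSuccEquiv k m).toRingEquiv)) (m + 3), H, Ideal.map_top]

/-- **THE cA-ARENA ENABLING FORMULA over `k[z₁,…,z_m]`, `char k ≠ 2`, every `h ≠ 0`, every `m` (fact-free):**
`ca(k[z][u][v]/(v² − u² + h)) = ρ⁻¹(ca(k[z]/(h)))`, i.e. for the arena `T_h = k[x, y, z]/(xy − h)` over the hypersurface centre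
`C_h = k[z]/(h)`: `ca(T_h) = (x, y) + ι(ca(C_h))·T_h`. [OURS · L1 w44b; plan-1 K-v13 (c) / CRUX-PLAN-SD-v0 (O3)] -/
theorem cohomologyAnnihilator_eq_comap_mvPolynomial {k : Type u} [Field k] (h2 : (2 : k) ≠ 0) {m : ℕ}
    (h : MvPolynomial (Fin m) k) (hh : h ≠ 0)
    (ρ : AdjoinRoot (X ^ 2 + C (-(X ^ 2 + C (-h))) : (MvPolynomial (Fin m) k)[X][X]) →+* MvPolynomial (Fin m) k ⧸ Ideal.span {h})
    (hρv : ρ (AdjoinRoot.root _) = 0) (hρu : ρ (AdjoinRoot.of _ X) = 0)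
    (hρC : ∀ s, ρ (AdjoinRoot.of _ (C s)) = Ideal.Quotient.mk (Ideal.span {h}) s) :
    cohomologyAnnihilator (AdjoinRoot (X ^ 2 + C (-(X ^ 2 + C (-h))) : (MvPolynomial (Fin m) k)[X][X])) =
      (cohomologyAnnihilator (MvPolynomial (Fin m) k ⧸ Ideal.span {h})).comap ρ :=
  cohomologyAnnihilator_eq_comap h (mem_nonZeroDivisors_of_ne_zero hh) (d := m)
    (cohomologyAnnihilatorOfDegree_polynomial_mvPolynomial_eq_top k m)
    (cohomologyAnnihilatorOfDegree_polynomial_polynomial_mvPolynomial_eq_top k m) (isUnit_two_mvPolynomial h2 m) ρ hρv hρu hρC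

/-! ## §5 The natural `ρ = AdjoinRoot.lift (eval₂RingHom mk 0) 0` -/

/-- Kernel condition for the natural `ρ : T → S/(h)`, `u, v ↦ 0`. [folklore] -/
theorem eval₂_arena_eq_zero (h : S) :
    eval₂ (eval₂RingHom (Ideal.Quotient.mk (Ideal.span {h})) 0) (0 : S ⧸ Ideal.span {h})
      (X ^ 2 + C (-(X ^ 2 + C (-h))) : S[X][X]) = 0 := by
  rw [eval₂_add, eval₂_X_pow, eval₂_C, zero_pow two_ne_zero, zero_add, map_neg, coe_eval₂RingHom,
    eval₂_add, eval₂_X_pow, eval₂_C, zero_pow two_ne_zero, zero_add, map_neg, neg_neg, Ideal.Quotient.eq_zero_iff_mem]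
  exact Ideal.mem_span_singleton_self h

/-- The natural `ρ` kills `v`. [folklore] -/
theorem lift_root (h : S) :
    AdjoinRoot.lift (eval₂RingHom (Ideal.Quotient.mk (Ideal.span {h})) 0) (0 : S ⧸ Ideal.span {h}) (eval₂_arena_eq_zero h)
      (AdjoinRoot.root _) = 0 :=
  AdjoinRoot.lift_root _

/-- The natural `ρ` kills `u`. [folklore] -/
theorem lift_of_X (h : S) :
    AdjoinRoot.lift (eval₂RingHom (Ideal.Quotient.mk (Ideal.span {h})) 0) (0 : S ⧸ Ideal.span {h}) (eval₂_arena_eq_zero h)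
      (AdjoinRoot.of _ X) = 0 := by
  rw [AdjoinRoot.lift_of, coe_eval₂RingHom, eval₂_X]

/-- The natural `ρ` is `s ↦ s̄` on `S`. [folklore] -/
theorem lift_of_C (h : S) (s : S) :
    AdjoinRoot.lift (eval₂RingHom (Ideal.Quotient.mk (Ideal.span {h})) 0) (0 : S ⧸ Ideal.span {h}) (eval₂_arena_eq_zero h)
      (AdjoinRoot.of _ (C s)) = Ideal.Quotient.mk (Ideal.span {h}) s := by
  rw [AdjoinRoot.lift_of, coe_eval₂RingHom, eval₂_C]

/-- UPPER HALF along the natural `ρ`: `(caⁿ⁺³(S[u][v]/(v² − u² + h))).map ρ ≤ caⁿ⁺¹(S/(h))`. [OURS · L1 w44b] -/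
theorem map_lift_cohomologyAnnihilatorOfDegree_le [IsNoetherianRing S] [Nontrivial S] (h : S) (hh : h ∈ S⁰) (n : ℕ) :
    (cohomologyAnnihilatorOfDegree (AdjoinRoot (X ^ 2 + C (-(X ^ 2 + C (-h))) : S[X][X])) (n + 3)).map
        (AdjoinRoot.lift (eval₂RingHom (Ideal.Quotient.mk (Ideal.span {h})) 0) (0 : S ⧸ Ideal.span {h}) (eval₂_arena_eq_zero h)) ≤
      cohomologyAnnihilatorOfDegree (S ⧸ Ideal.span {h}) (n + 1) :=
  map_cohomologyAnnihilatorOfDegree_le h hh n _ (lift_root h) (lift_of_X h) (lift_of_C h)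

/-- BOTH HALVES along the natural `ρ`, over `k[z₁,…,z_m]` with `char k ≠ 2`:
`ca(k[z][u][v]/(v² − u² + h)) = ρ⁻¹(ca(k[z]/(h)))`. [OURS · L1 w44b] -/
theorem cohomologyAnnihilator_eq_comap_lift_mvPolynomial {k : Type u} [Field k] (h2 : (2 : k) ≠ 0) {m : ℕ}
    (h : MvPolynomial (Fin m) k) (hh : h ≠ 0) :
    cohomologyAnnihilator (AdjoinRoot (X ^ 2 + C (-(X ^ 2 + C (-h))) : (MvPolynomial (Fin m) k)[X][X])) =
      (cohomologyAnnihilator (MvPolynomial (Fin m) k ⧸ Ideal.span {h})).comap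
        (AdjoinRoot.lift (eval₂RingHom (Ideal.Quotient.mk (Ideal.span {h})) 0) (0 : MvPolynomial (Fin m) k ⧸ Ideal.span {h})
          (eval₂_arena_eq_zero h)) :=
  cohomologyAnnihilator_eq_comap_mvPolynomial h2 h hh _ (lift_root h) (lift_of_X h) (lift_of_C h)

end Summit.ResolutionOfSingularities.ResolutionOfSingularities.Theorems.HomologicalConductor.ArenaDescent

end
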